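import Summits.Ventures.PercRepro.ProfileGapMonoColoopBandSucc

/-!
# PercRepro — LOOPS SCALE THE THRESHOLD FAMILY (p5, gen 23; `proofs/P5-GM1.md` §21(m); announced INBOX 11577)

A loop `ℓ` doubles every count of the threshold family: `thresholdSum N q t = 2 · thresholdSum (N ∖ ℓ) q t` (each
rank-`(q−1)` set of `N ∖ ℓ` gives two of `N`, with the same complement rank) and, by p10's `card_levelSetCoQ_loop`,
`#T_t(N) = 2 · #T_t(N ∖ ℓ)`; so `Φ_t(N) = 2 · Φ_t(N ∖ ℓ)`, `(I_t)(N)` follows from `(I_t)(N ∖ ℓ)`, and a loop is a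
deletion-monotone point exactly when `(I_t)` holds for `N ∖ ℓ`.

* `thresholdTerm_delete_loop_eq`, `thresholdTerm_erase_loop_eq`, **`thresholdSum_loop`**,
  **`thresholdIneq_of_loop`**, `delMonoT_of_loop`.
-/

open scoped Matroid

namespace PercRepro.Cogirth

open Finset ThmH Skew Shadow Profile

variable {α : Type} [DecidableEq α] {M : Matroid α} [M.Finite]

section ThresholdLoop

variable {N : Matroid α} [N.Finite] {ℓ : α} {q t : ℕ}

/-- The threshold term of a set `B` is the same in `N ∖ ℓ` and in `N` (`ℓ` a loop; `B` arbitrary — the complement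
in `N ∖ ℓ` is the complement in `N` without `ℓ`). -/
theorem thresholdTerm_delete_loop_eq (hℓ : ℓ ∈ gr N) (h0 : rk N {ℓ} = 0) (B : Finset α) :
    (if t + 1 ≤ rk (N ＼ ({ℓ} : Set α)) (gr (N ＼ ({ℓ} : Set α)) \ B) then
        rk (N ＼ ({ℓ} : Set α)) (gr (N ＼ ({ℓ} : Set α)) \ B) else 0) =
      (if t + 1 ≤ rk N (gr N \ B) then rk N (gr N \ B) else 0) := by
  have h1 : gr (N ＼ ({ℓ} : Set α)) \ B = (gr N \ B).erase ℓ := by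
    rw [gr_delete']
    ext x
    simp only [mem_sdiff, mem_erase]
    tauto
  have h2 : rk (N ＼ ({ℓ} : Set α)) (gr (N ＼ ({ℓ} : Set α)) \ B) = rk N (gr N \ B) := by
    rw [h1, rk_delete (by rw [← h1, gr_delete']; exact sdiff_subset), rk_erase_of_loop hℓ h0 sdiff_subset]
  rw [h2]

/-- The threshold term of a set `B ∋ ℓ` in `N` is that of `B ∖ ℓ` in `N ∖ ℓ` (`ℓ` a loop). -/
theorem thresholdTerm_erase_loop_eq (hℓ : ℓ ∈ gr N) (h0 : rk N {ℓ} = 0) {B : Finset α} (hℓB : ℓ ∈ B) :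
    (if t + 1 ≤ rk N (gr N \ B) then rk N (gr N \ B) else 0) =
      (if t + 1 ≤ rk (N ＼ ({ℓ} : Set α)) (gr (N ＼ ({ℓ} : Set α)) \ B.erase ℓ) then
        rk (N ＼ ({ℓ} : Set α)) (gr (N ＼ ({ℓ} : Set α)) \ B.erase ℓ) else 0) := by
  rw [thresholdTerm_delete_loop_eq (t := t) hℓ h0 (B.erase ℓ)]
  have h1 : gr N \ B.erase ℓ = insert ℓ (gr N \ B) := by
    ext x
    simp only [mem_sdiff, mem_erase, mem_insert, not_and]
    constructor
    · rintro ⟨hx, hxB⟩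
      by_cases hxℓ : x = ℓ
      · exact Or.inl hxℓ
      · exact Or.inr ⟨hx, fun h => absurd (hxB hxℓ) (fun h' => h' h)⟩
    · rintro (rfl | ⟨hx, hxB⟩)
      · exact ⟨hℓ, fun h => absurd rfl h⟩
      · exact ⟨hx, fun _ => hxB⟩
  rw [h1, rk_insert_of_loop hℓ h0 sdiff_subset]

/-- **A loop doubles the threshold demand**: `thresholdSum N q t = 2 · thresholdSum (N ∖ ℓ) q t`. -/
theorem thresholdSum_loop (hℓ : ℓ ∈ gr N) (h0 : rk N {ℓ} = 0) :
    thresholdSum N q t = 2 * thresholdSum (N ＼ ({ℓ} : Set α)) q t := by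
  unfold thresholdSum
  rw [← sum_filter_add_sum_filter_not (Rq N (q - 1)) (fun B => ℓ ∈ B), sum_Rq_filter_mem_loop hℓ h0,
    ← Rq_delete_eq_filter, two_mul]
  have hA : ∑ B ∈ Rq (N ＼ ({ℓ} : Set α)) (q - 1),
      (if t + 1 ≤ rk N (gr N \ insert ℓ B) then rk N (gr N \ insert ℓ B) else 0) =
      ∑ B ∈ Rq (N ＼ ({ℓ} : Set α)) (q - 1),
        (if t + 1 ≤ rk (N ＼ ({ℓ} : Set α)) (gr (N ＼ ({ℓ} : Set α)) \ B) then
          rk (N ＼ ({ℓ} : Set α)) (gr (N ＼ ({ℓ} : Set α)) \ B) else 0) := by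
    refine sum_congr rfl (fun B hB => ?_)
    have hℓB : ℓ ∉ B := by
      have := (mem_Rq.1 hB).1
      rw [gr_delete'] at this
      exact fun h => (mem_erase.1 (this h)).1 rfl
    rw [thresholdTerm_erase_loop_eq (t := t) hℓ h0 (mem_insert_self ℓ B), erase_insert hℓB]
  have hB : ∑ B ∈ Rq (N ＼ ({ℓ} : Set α)) (q - 1),
      (if t + 1 ≤ rk N (gr N \ B) then rk N (gr N \ B) else 0) =
      ∑ B ∈ Rq (N ＼ ({ℓ} : Set α)) (q - 1),
        (if t + 1 ≤ rk (N ＼ ({ℓ} : Set α)) (gr (N ＼ ({ℓ} : Set α)) \ B) then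
          rk (N ＼ ({ℓ} : Set α)) (gr (N ＼ ({ℓ} : Set α)) \ B) else 0) :=
    sum_congr rfl (fun B _ => (thresholdTerm_delete_loop_eq (t := t) hℓ h0 B).symm)
  rw [hA, hB]

/-- **`(I_t)` at a loop from `(I_t)` of the deletion**: both sides double. -/
theorem thresholdIneq_of_loop (hℓ : ℓ ∈ gr N) (h0 : rk N {ℓ} = 0)
    (h : ThresholdIneq (N ＼ ({ℓ} : Set α)) q t) : ThresholdIneq N q t := by
  unfold ThresholdIneq at h ⊢
  rw [thresholdSum_loop hℓ h0, card_levelSetCoQ_loop hℓ h0, Nat.mul_left_comm]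
  omega

/-- A loop is a deletion-monotone point exactly when `(I_t)` holds for the deletion (`Φ_t(N) = 2 · Φ_t(N ∖ ℓ)`). -/
theorem delMonoT_of_loop (hℓ : ℓ ∈ gr N) (h0 : rk N {ℓ} = 0)
    (h : ThresholdIneq (N ＼ ({ℓ} : Set α)) q t) : DelMonoT N ℓ q t := by
  unfold DelMonoT
  unfold ThresholdIneq at h
  rw [thresholdSum_loop hℓ h0, card_levelSetCoQ_loop hℓ h0, Nat.mul_left_comm]
  omega

end ThresholdLoop

end PercRepro.Cogirth
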